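import Literature.Geometry.Lorentzian.KerrConvergenceProofs
import Literature.Geometry.Lorentzian.KerrEnergyIdentity
import Summits.FinalStateConjecture.FinalStateConjecture.Theorems.EIHFluxBalanceInertialRecessionCalculus

/-!
# Route EIHFluxBalance — `InertialRecession` (stmt-FinalStateConjecture-10166): smoothness of the modulated ansatz

Helper file for the crux `InertialRecession` (registered helper stub `contDiffAt_ansatzBilin`).
The reference field of the crux antecedent is the modulated multi-centre Kerr–Schild ansatz
`G(λ(x⁰))(x) = η + Σᵢ (g_{Mᵢ,aᵢ}(Λᵢ(x⁰)⁻¹(x − cᵢ(x⁰)))(Λᵢ(x⁰)⁻¹·, Λᵢ(x⁰)⁻¹·) − η)`, `cᵢ(t) = (t, ξᵢ(t))`,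
with `t ↦ Λᵢ(t)` smooth into `E4 →L[ℝ] E4` and `ξᵢ` smooth. Every use of the smooth-deviation lemma
`contDiffAt_deviationExtend_of_bilin` (wall-influx budget, flat chart, re-charting) needs: **the ansatz is
`C^∞` at each point all of whose painted Kerr–Schild radii are positive.** This file proves exactly that:
the inverse frame `t ↦ Λᵢ(t)⁻¹` is smooth (inversion on the units of `E4 →L[ℝ] E4`), the centre event is
smooth, each summand is smooth by the chain rule with `Kerr.contDiffAt_bilin` and the polynomial map
`(T, A) ↦ T(A·, A·)` (`contDiffWithinAt_bilinearComp_self`), and the finite sum is smooth.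
-/

noncomputable section

open scoped BigOperators Topology Manifold ContDiff
open Filter Set Function Literature.Geometry.Lorentzian

namespace Summit.FinalStateConjecture.FinalStateConjecture.Theorems

/-! ### Smoothness of the modulated multi-Kerr–Schild ansatz -/

/-- If the painted frame `t ↦ Λ(t)` is `Cⁿ` as a map into `E4 →L[ℝ] E4`, so is the inverse frame
`t ↦ Λ(t)⁻¹` (inversion is analytic on the units of the Banach algebra `E4 →L[ℝ] E4`). [folklore] -/
theorem contDiff_lorentz_symm {Λ : ℝ → lorentzGroup} {n : WithTop ℕ∞}
    (hΛ : ContDiff ℝ n (fun t ↦ ((Λ t : E4 ≃L[ℝ] E4) : E4 →L[ℝ] E4))) :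
    ContDiff ℝ n (fun t ↦ (((Λ t : E4 ≃L[ℝ] E4).symm : E4 ≃L[ℝ] E4) : E4 →L[ℝ] E4)) := by
  have h : (fun t ↦ (((Λ t : E4 ≃L[ℝ] E4).symm : E4 ≃L[ℝ] E4) : E4 →L[ℝ] E4)) =
      fun t ↦ ContinuousLinearMap.inverse ((Λ t : E4 ≃L[ℝ] E4) : E4 →L[ℝ] E4) := by
    funext t
    rw [ContinuousLinearMap.inverse_equiv]
  rw [h, contDiff_iff_contDiffAt]
  intro t
  exact (contDiffAt_map_inverse (Λ t : E4 ≃L[ℝ] E4)).comp t hΛ.contDiffAt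

/-- The painted centre event `x ↦ (x⁰, ξ(x⁰))` is smooth along a smooth centre curve `ξ`. [folklore] -/
theorem contDiff_centreEvent {ξ : ℝ → E3} (hξ : ContDiff ℝ ∞ ξ) :
    ContDiff ℝ ∞ (fun y : E4 ↦ E4.ofTimeSpace (y 0) (ξ (y 0))) := by
  have h0 : ContDiff ℝ ∞ (fun y : E4 ↦ y 0) := (EuclideanSpace.proj (0 : Fin 4) (𝕜 := ℝ)).contDiff
  have e : (fun y : E4 ↦ E4.ofTimeSpace (y 0) (ξ (y 0))) =
      fun y : E4 ↦ (y 0) • E4.basisVector 0 + E4.spaceEmbed (ξ (y 0)) :=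
    funext fun y ↦ E4.ofTimeSpace_eq_smul_add' _ _
  rw [e]
  exact (h0.smul contDiff_const).add (E4.spaceEmbed.contDiff.comp (hξ.comp h0))

/-- **One modulated boosted Kerr–Schild summand is smooth where its painted radius is positive.**
`x ↦ g_{M,a}(Λ(x⁰)⁻¹(x − c(x⁰)))(Λ(x⁰)⁻¹·, Λ(x⁰)⁻¹·)` is `C^∞` at `x` if
`r_a(Λ(x⁰)⁻¹(x − c(x⁰))) > 0`, for smooth `Λ`, `ξ` (chain rule with `Kerr.contDiffAt_bilin`,
Kerr–Schild 1965, §3). [cite: KerrSchild1965, §3] -/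
theorem contDiffAt_boostedKerrBilin_modulated {Λ : ℝ → lorentzGroup} {ξ : ℝ → E3} (M a : ℝ)
    (hΛ : ContDiff ℝ ∞ (fun t ↦ ((Λ t : E4 ≃L[ℝ] E4) : E4 →L[ℝ] E4)))
    (hξ : ContDiff ℝ ∞ ξ) {x : E4}
    (hx : 0 < Kerr.radius a (poincareInv (Λ (x 0)) (E4.ofTimeSpace (x 0) (ξ (x 0))) x)) :
    ContDiffAt ℝ ∞
      (fun y : E4 ↦ boostedKerrBilin (Λ (y 0)) (E4.ofTimeSpace (y 0) (ξ (y 0))) M a y) x := by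
  have h0 : ContDiff ℝ ∞ (fun y : E4 ↦ y 0) := (EuclideanSpace.proj (0 : Fin 4) (𝕜 := ℝ)).contDiff
  have hA : ContDiff ℝ ∞
      (fun y : E4 ↦ (((Λ (y 0) : E4 ≃L[ℝ] E4).symm : E4 ≃L[ℝ] E4) : E4 →L[ℝ] E4)) :=
    (contDiff_lorentz_symm hΛ).comp h0
  have hP : ContDiff ℝ ∞
      (fun y : E4 ↦ poincareInv (Λ (y 0)) (E4.ofTimeSpace (y 0) (ξ (y 0))) y) := by
    show ContDiff ℝ ∞ (fun y : E4 ↦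
      ((Λ (y 0) : E4 ≃L[ℝ] E4).symm) (y - E4.ofTimeSpace (y 0) (ξ (y 0))))
    exact hA.clm_apply (contDiff_id.sub (contDiff_centreEvent hξ))
  have hK : ContDiffAt ℝ ∞ (fun y : E4 ↦ Kerr.bilin M a
      (poincareInv (Λ (y 0)) (E4.ofTimeSpace (y 0) (ξ (y 0))) y)) x :=
    ContDiffAt.comp (f := fun y : E4 ↦ poincareInv (Λ (y 0)) (E4.ofTimeSpace (y 0) (ξ (y 0))) y)
      x (Kerr.contDiffAt_bilin M a hx) hP.contDiffAt
  have hB := contDiffWithinAt_bilinearComp_self (s := Set.univ) hK.contDiffWithinAt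
    hA.contDiffAt.contDiffWithinAt
  rw [contDiffWithinAt_univ] at hB
  refine hB.congr_of_eventuallyEq (Filter.Eventually.of_forall fun y ↦ ?_)
  show boostedKerrBilin (Λ (y 0)) (E4.ofTimeSpace (y 0) (ξ (y 0))) M a y =
    (Kerr.bilin M a (poincareInv (Λ (y 0)) (E4.ofTimeSpace (y 0) (ξ (y 0))) y)).bilinearComp
      (((Λ (y 0) : E4 ≃L[ℝ] E4).symm : E4 ≃L[ℝ] E4) : E4 →L[ℝ] E4)
      (((Λ (y 0) : E4 ≃L[ℝ] E4).symm : E4 ≃L[ℝ] E4) : E4 →L[ℝ] E4)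
  rw [bilinearComp_self_eq_comp]
  rfl

/-- **The modulated multi-centre ansatz `η + Σᵢ (g_{Mᵢ,aᵢ} ∘ Λᵢ(x⁰)⁻¹(· − cᵢ(x⁰)) − η)` is smooth at every
point all of whose painted radii are positive** (finite sum of the previous lemma). [folklore] -/
theorem contDiffAt_ansatzBilin' (N : ℕ) (M a : Fin N → ℝ) (Λ : Fin N → ℝ → lorentzGroup)
    (ξ : Fin N → ℝ → E3)
    (hΛ : ∀ i, ContDiff ℝ ((⊤ : ℕ∞) : WithTop ℕ∞) (fun t ↦ ((Λ i t : E4 ≃L[ℝ] E4) : E4 →L[ℝ] E4)))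
    (hξ : ∀ i, ContDiff ℝ ((⊤ : ℕ∞) : WithTop ℕ∞) (ξ i)) (x : E4)
    (hx : ∀ i, 0 < Kerr.radius (a i)
      (poincareInv (Λ i (x 0)) (E4.ofTimeSpace (x 0) (ξ i (x 0))) x)) :
    ContDiffAt ℝ ((⊤ : ℕ∞) : WithTop ℕ∞) (fun y : E4 ↦ Minkowski.bilin + ∑ i, (boostedKerrBilin (Λ i (y 0))
      (E4.ofTimeSpace (y 0) (ξ i (y 0))) (M i) (a i) y - Minkowski.bilin)) x := by
  refine contDiffAt_const.add ?_
  exact ContDiffAt.sum (s := Finset.univ) fun i _ ↦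
    (contDiffAt_boostedKerrBilin_modulated (M i) (a i) (hΛ i) (hξ i) (hx i)).sub contDiffAt_const

/-- Registered one-line form (helper stub `contDiffAt_ansatzBilin` of the crux item) of
`contDiffAt_ansatzBilin'`: the modulated multi-centre Kerr–Schild ansatz is `C^∞` at every point all of
whose painted radii are positive. [folklore] -/
theorem contDiffAt_ansatzBilin : open Literature.Geometry.Lorentzian in ∀ (N : ℕ) (M a : Fin N → ℝ) (Λ : Fin N → ℝ → lorentzGroup) (ξ : Fin N → ℝ → E3), (∀ i, ContDiff ℝ ((⊤ : ℕ∞) : WithTop ℕ∞) (fun t ↦ ((Λ i t : E4 ≃L[ℝ] E4) : E4 →L[ℝ] E4))) → (∀ i, ContDiff ℝ ((⊤ : ℕ∞) : WithTop ℕ∞) (ξ i)) → ∀ (x : E4), (∀ i, 0 < Kerr.radius (a i) (poincareInv (Λ i (x 0)) (E4.ofTimeSpace (x 0) (ξ i (x 0))) x)) → ContDiffAt ℝ ((⊤ : ℕ∞) : WithTop ℕ∞) (fun y : E4 ↦ Minkowski.bilin + ∑ i, (boostedKerrBilin (Λ i (y 0)) (E4.ofTimeSpace (y 0) (ξ i (y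 0))) (M i) (a i) y - Minkowski.bilin)) x :=
  contDiffAt_ansatzBilin'

end Summit.FinalStateConjecture.FinalStateConjecture.Theorems

end
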